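import Mathlib.Analysis.SpecialFunctions.Complex.Circle
import Mathlib.Analysis.SpecialFunctions.Trigonometric.Basic
import Mathlib.Data.ZMod.Basic
import HarnessLib
import HarnessLib.Audit.Tags

/-!
# Venture YMGap — Conjectures/ChiralClockComparison.lean: the CHIRAL ℤ₃ COMPARISON CONJECTURE (C), TYPED — the one open point of the
# centre-blind β-ladder for ODD N (SU(3)), as an `@[conjecture] def … : Prop` about finite sums (no measure theory, no gauge fields)

HONEST FRAMING (venture `Summits/Ventures/YMGap`, cell `pub-ymgap`, track Y2 ROBUST-BALL, seat ds-4 g13).  This file ASSERTS NOTHING: it types ONE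
open, falsifiable statement about the `ℤ₃` clock model on a finite vertex set with COMPLEX nearest-neighbour couplings `z_{xy} = a_{xy} e^{iφ_{xy}}`
(weights `exp(∑_{x,y} a_{xy} cos(2π(k_x − k_y)/3 + φ_{xy}))`, `k : V → ℤ₃`): the modulus of its two-point function `⟨ω^{k_b − k_t}⟩` is at most the
two-point function of the FERROMAGNETIC model with the same moduli `a_{xy}` and all phases `0` (the 3-state Potts / clock ferromagnet) — the `ℤ₃` analogue
of the `ℤ₂` fact `|⟨σ_bσ_t⟩_J| ≤ ⟨σ_bσ_t⟩_{|J|}` (GKS II) that drives every `SU(2)` / even-`N` rung of the ladder (`RobustBall/CentreBlindZ2Domination`,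
`CentreProjectionEvenDomination`).  WHY IT MATTERS: the centre projection of an `SU(3)` background (tree `abs_expectation_wilsonLoop_le_of_isTwistBlind`)
produces exactly such a model on the layers, with `a ≤ 3|β|` and ARBITRARY phases; (C) would dominate the whole `SU(3)` linkwise-centre-blind class
loop-by-loop by a `ℤ₃` ferromagnet and open the star / ball / subcritical-layer rungs for odd `N` (today: rung 1 = Dobrushin, `|β| < 1/18` in `d = 4`).
STATUS: CONJECTURE with numerical support only — 0 violations in 1 588 832 random coupling/phase configurations (24 793 956 ordered pairs) + 30 104
hill-climbs on 14 graphs with ≤ 10 vertices, `a_e ≤ 8` (kit j227082, exact enumeration, float64, worst excess 1.3e-15), single-edge case PROVED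
(dossier `HOME/ds/ds4/SUBCRITICAL-LAYER.md` §8g); + PRE-REGISTERED ROUND 1 (predictions sealed in `HOME/ds/ds4/oddN/PREREG-C-round1.md`, sha256
3f4d30db…, BEFORE kit j229411 ran; products `j229411.prereg_round1.json` 221133ef3200d8e6; referee g36 mechanical re-score F-677, cell bus
2026-08-24 l.7000): 14/14 HIT — 11 named graphs on `n = 11, 12` vertices by exact `3ⁿ` enumeration (0 violations each, worst margin ≤ −1.2e-11),
cycles `C_L`, `L ≤ 40` (186 306 pair checks, 0 violations; the cycles sit at equality up to roundoff), strips `2×L` / `3×L` (281 504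
configurations, 0 violations), and the positive control (the refuted equal-modulus variant) firing (1 401 / 20 000); evidence, not proof; the
stronger «equal-Fourier-modulus» variant is FALSE (`K4` counterexample, §8h) — so (C)'s slack `t(a,0) ≥ t(a,φ)` is needed.  Literature: Ginibre
1970's cone needs nonnegative Fourier coefficients (the phases break it); Brydges–Fröhlich–Seiler diamagnetic inequalities need Gaussian / rotator
matter; J. Fröhlich, Phys. Lett. B 83 (1979) 195 («Z_n confinement ⇒ SU(n) confinement») NOT HELD (acq-10704) — it may contain or presuppose (C).
Nothing here is about gauge fields, limits, confinement or the Clay problem.  Text: ds-4 g13 (round-1 evidence sentence: p3 g11, ds-4's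
delegation, cell bus 2026-08-24 l.6987, after the referee's re-score l.7000 as the chair ruled l.6995); proposer: p3 / the lead (R158-type
countersign); NOT proposed by ds-4.
-/

noncomputable section

open Finset Complex

namespace Summit.Ventures.YMGap.Conjectures

/-- The weight of a `ℤ₃` clock configuration `k : Fin n → ZMod 3` with couplings `a x y ≥ 0` and phases `φ x y` on ORDERED pairs (a non-edge is
`a x y = 0`; an unordered edge may be entered once or split between `(x,y)` and `(y,x)`):
`exp(∑_x ∑_y a x y · cos(2π((k x − k y).val)/3 + φ x y))`. [folklore] -/
def chiralClockWeight {n : ℕ} (a φ : Fin n → Fin n → ℝ) (k : Fin n → ZMod 3) : ℝ :=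
  Real.exp (∑ x, ∑ y, a x y * Real.cos (2 * Real.pi * ((k x - k y).val : ℝ) / 3 + φ x y))

/-- The character `ω^{m} = exp(2πi m/3)` of `m ∈ ℤ₃`. [folklore] -/
def omegaPow (m : ZMod 3) : ℂ := Complex.exp (2 * Real.pi * Complex.I * (m.val : ℂ) / 3)

/-- The two-point function `⟨ω^{k_b − k_t}⟩_{a,φ} = (∑_k w(k) ω^{k_b − k_t}) / (∑_k w(k))` of the chiral `ℤ₃` clock model on `Fin n`. [folklore] -/
def chiralClockCorr {n : ℕ} (a φ : Fin n → Fin n → ℝ) (b t : Fin n) : ℂ :=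
  (∑ k : Fin n → ZMod 3, (chiralClockWeight a φ k : ℂ) * omegaPow (k b - k t)) /
    (∑ k : Fin n → ZMod 3, (chiralClockWeight a φ k : ℂ))

/-- **CONJECTURE (C) «chiral ℤ₃ comparison».**  For every finite vertex set `Fin n`, all couplings `a ≥ 0`, all phases `φ`, and all `b, t`:
`‖⟨ω^{k_b − k_t}⟩_{a,φ}‖ ≤ Re ⟨ω^{k_b − k_t}⟩_{a,0}` (the right-hand side is the ferromagnetic 3-state clock / Potts two-point function, real and
nonnegative by Griffiths' first inequality).  Evidence and status in the module docstring; equality holds on trees and whenever `φ` is a `ℤ₃`-gauge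
(`φ x y ∈ (2π/3)ℤ`-valued coboundary). [cite: MackPetkova1979, §2 (the ℤ₂ case, N = 2)] -/
@[conjecture] def ChiralClockComparison : Prop :=
  ∀ (n : ℕ) (a φ : Fin n → Fin n → ℝ), (∀ x y, 0 ≤ a x y) → ∀ b t : Fin n,
    ‖chiralClockCorr a φ b t‖ ≤ (chiralClockCorr a (fun _ _ => 0) b t).re

end Summit.Ventures.YMGap.Conjectures

end
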